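import Summits.CriticalPhenomena.PercolationContinuityZ3.Theorems.PercNearOneGluingNoHeavyQuantFarTwoAnchorLoadedTransfer
import Summits.CriticalPhenomena.PercolationContinuityZ3.Theorems.PercNearOneGluingNoHeavyQuantFarLayerOneUnicyclicAll
import HarnessLib

/-!
# QUANT lane R8, front "FAR beyond trees", layer one — FIRST GRAPHS WITH TWO CYCLES: a unicyclic graph plus one pendant block loaded at
# two vertices (figure-eights with a two-anchor second block, cycle + pendant K₄, …) satisfy FAR at layer one, unconditionally

builds on p205010 (kernel theorem, internal audit signed; external expert review pending)

Support file (`--supports stmt-CriticalPhenomena-4575`), seat `prim-quant-p1` (gen 19); memo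
`run/shared/lean/prim/quant/prim-quant-p1-g19/FOR-LEAD-CACTI.md` §3/§5.  Standard axioms; no sorries; no definitions.

The two-anchor transfer (`Block.farLayerOne_twoAnchor_loaded`, this seat) composed with the unconditional unicyclic theorem of p1 g18 /
prim-cert-1 g23 (`Bundle.layerOne_of_pforest_cycleObs`, `Bundle.layerOne_of_pforest_treeObs_all`: every pendant forest on a cycle, all-K `SunFAR`):
if the DECOUPLED weights `Block.decouple c v₁ v₂ Z L par w` of a two-anchor pendant block (arbitrary 2-connected core hanging at the cut vertex `c`,
relays = hair leaves and/or the two anchors) are presented as a pendant forest on a cycle (`Bundle.PForest`), then the `j = 1` instance of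
`Quant.FarRelayRow` holds for `w` itself — for the observer on the cycle (`Block.layerOne_of_pforest_plus_twoAnchor`) or in a pendant tree
(`Block.layerOne_of_pforest_plus_twoAnchor_treeObs`).  These are the first supports with cyclomatic number 2 on which the layer-one row is a
kernel theorem.  [cite: KozmaNitzan2024, Conjecture 3 (p. 15)] (the row); [this work].
-/

noncomputable section

namespace Summit.CriticalPhenomena.PercolationContinuityZ3.Theorems

namespace Quant

namespace Block

open Finset MeasureTheory Set
open Literature.Probability.LatticeModels
open Literature.Probability.Percolation
open scoped Classical

variable {n : ℕ} {c v₁ v₂ : Fin n} {Z L : Finset (Fin n)} {par : Fin n → Fin n}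
  {Lc : ℕ} {cyc : ℕ → Fin n} {idx : Fin n → ℕ} {T : Finset (Fin n)} {par' : Fin n → Fin n} {dep : Fin n → ℕ}

/-- **FAR at layer one on a unicyclic graph with one pendant two-anchor block, observer on the cycle.**  If the decoupled weights of the
block form a pendant forest on a cycle with the relays in the forest or on the cycle, then for the ORIGINAL weights `w`:
`2 < Σ_{a∈A} P_w(c₀ ↔ a)` and `P_w(c₀ ↮ a) ≤ t` on `A` imply `P_w(#{a ∈ A : c₀ ↔ a} ≤ 1) ≤ t`. [this work] -/
theorem layerOne_of_pforest_plus_twoAnchor (H : IsTwoAnchor c v₁ v₂ Z L par) (w : Sym2 (Fin n) → unitInterval)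
    (hwZ : ∀ x y : Fin n, x ≠ y → x ∈ Z → y ∉ Z → y ≠ c → (w s(x, y) : ℝ) = 0)
    (hwL : ∀ ℓ ∈ L, ∀ x : Fin n, x ≠ ℓ → x ≠ par ℓ → (w s(ℓ, x) : ℝ) = 0)
    (A : Finset (Fin n)) (hA : A ∩ Z ⊆ L ∪ {v₁, v₂}) (hAZ : (A ∩ Z).Nonempty)
    (P : Bundle.PForest Lc cyc idx T par' dep (decouple c v₁ v₂ Z L par w)) (ho : cyc 0 ∉ Z)
    (hA' : ∀ a ∈ A, a ∈ T ∨ ∃ i, i < Lc ∧ a = cyc i) (t : ℝ)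
    (hEN : (2 : ℝ) < ∑ a ∈ A, (prodBernoulli w).real (openConn (cyc 0) a))
    (hcut : ∀ a ∈ A, (prodBernoulli w).real (openConn (cyc 0) a : Set (BondConfig (Fin n)))ᶜ ≤ t) :
    (prodBernoulli w).real {ω : BondConfig (Fin n) | (A.filter fun a => ω ∈ openConn (cyc 0) a).card ≤ 1} ≤ t :=
  farLayerOne_twoAnchor_loaded H w ho hwZ hwL A hA hAZ t
    (fun hEN' hcut' => Bundle.layerOne_of_pforest_cycleObs P A hA' t hEN' hcut') hEN hcut

/-- **The same with the observer in a pendant tree of the presentation** (`par'^[k+1] o = c₀`, the chain staying in `T`; `o` off the block).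
[this work] -/
theorem layerOne_of_pforest_plus_twoAnchor_treeObs (H : IsTwoAnchor c v₁ v₂ Z L par) (w : Sym2 (Fin n) → unitInterval)
    {o : Fin n} (ho : o ∉ Z)
    (hwZ : ∀ x y : Fin n, x ≠ y → x ∈ Z → y ∉ Z → y ≠ c → (w s(x, y) : ℝ) = 0)
    (hwL : ∀ ℓ ∈ L, ∀ x : Fin n, x ≠ ℓ → x ≠ par ℓ → (w s(ℓ, x) : ℝ) = 0)
    (A : Finset (Fin n)) (hA : A ∩ Z ⊆ L ∪ {v₁, v₂}) (hAZ : (A ∩ Z).Nonempty)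
    (P : Bundle.PForest Lc cyc idx T par' dep (decouple c v₁ v₂ Z L par w)) {k : ℕ} (hk : par'^[k + 1] o = cyc 0)
    (hchain : ∀ j, j ≤ k → par'^[j] o ∈ T)
    (hA' : ∀ a ∈ A, a ∈ T ∨ ∃ i, i < Lc ∧ a = cyc i) (t : ℝ)
    (hEN : (2 : ℝ) < ∑ a ∈ A, (prodBernoulli w).real (openConn o a))
    (hcut : ∀ a ∈ A, (prodBernoulli w).real (openConn o a : Set (BondConfig (Fin n)))ᶜ ≤ t) :
    (prodBernoulli w).real {ω : BondConfig (Fin n) | (A.filter fun a => ω ∈ openConn o a).card ≤ 1} ≤ t :=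
  farLayerOne_twoAnchor_loaded H w ho hwZ hwL A hA hAZ t
    (fun hEN' hcut' => Bundle.layerOne_of_pforest_treeObs_all P hk hchain A hA' t hEN' hcut') hEN hcut

end Block

end Quant

end Summit.CriticalPhenomena.PercolationContinuityZ3.Theorems
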